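import Mathlib.Analysis.Calculus.SmoothSeries
import Mathlib.Analysis.Calculus.MeanValue
import Mathlib.Topology.MetricSpace.Contracting
import Mathlib.Analysis.InnerProductSpace.LinearMap
import Summits.AtomisticToContinuum.Crystallization.Theorems.ExcessDecayLiouvilleTwoLatticeForce
import Summits.AtomisticToContinuum.Crystallization.Theorems.ExcessDecayLiouvilleLinearisation
import Summits.AtomisticToContinuum.Crystallization.Theorems.ExcessDecayLiouvilleFarField

/-!
# `ExcessDecayLiouville.HcpLiouville` (stmt-AtomisticToContinuum-9332), line `Sketch`: a Newton certificate for the relaxed shift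

Helper for stub `stub_anchor` of the line `two-level-caccioppoli` (crux `HcpLiouville`).  By
`ExcessDecayLiouvilleHcpLiouvilleTwoLatticeForce.lean` (`stub_anchorReduction`) the anchor is exactly a
zero `e`, within `1/40` of the ideal shift `A(w₀ + √(2/3)e₃)`, of the **optical force** of the admissible
cell `A`,

`optForce A e = Σ'_{z ∈ Λ₀} (V′(|e + Az|)/|e + Az|)·(e + Az)`.

This file turns the existence of such a zero into finitely many INEQUALITIES (a Newton–Kantorovich /
Krawczyk certificate), so that it can be discharged by a certified computation:

* `forceConst w` — the pair force-constant operator `K(w) = h(|w|²)·1 + 2h′(|w|²)·(w ⊗ w)`,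
  `h(x) = −x⁻⁷ + x⁻⁴`; `hasFDerivAt_ljForce` : it is the differential of the pair force
  `v ↦ (V′(|v|)/|v|)·v` at every bond `|w| ≥ 9/10` (from the explicit Taylor remainder
  `norm_ljForce_linearisation_le`); `norm_forceConst_le` : `‖K(w)‖ ≤ 38|w|⁻⁸`;
* `optForceConst A e = Σ'_{z} K(e + Az)`; `hasFDerivAt_optForce` : on the ball `|e − A(w₀+√(2/3)e₃)| < 3/100`
  the optical force is differentiable with differential `optForceConst A e` (termwise differentiation,
  summable majorant `50·|A(w₀+√(2/3)e₃+z)|⁻⁸` over the `189/200`-separated shifted lattice);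
* `exists_zero_of_newton_contract` : Banach's fixed point theorem for `x ↦ x − M(g x)` on a closed ball;
* `stub_anchorNewton` (registered sub-goal) : if for some injective `M`, centre `c`, radius `r ≥ 0` and
  `0 ≤ q < 1` with `closedBall c r ⊆ closedBall (A(w₀+√(2/3)e₃)) (1/40)` one has
  `‖1 − M ∘ optForceConst A e‖ ≤ q` on `closedBall c r` and `‖M(optForce A c)‖ ≤ (1 − q)·r`, then the
  optical force has a zero within `1/40` of the ideal shift (the `RelaxedShift` input of the anchor, in the
  `HasSum` form of `stub_anchorReduction`).

All `[folklore]`; a `--supports` helper for item stmt-AtomisticToContinuum-9332, nothing here closes an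
item.
-/

noncomputable section

namespace Summit.AtomisticToContinuum.Crystallization.Theorems.ExcessDecayLiouville

open scoped BigOperators Topology Classical InnerProductSpace RealInnerProductSpace
open Literature.MathematicalPhysics.StatisticalMechanics
open Summit.AtomisticToContinuum.Crystallization.Theses.ExcessDecayLiouville
open Summit.AtomisticToContinuum.Crystallization.Theorems.PhononStabilityNegative

local notation "E3" => EuclideanSpace ℝ (Fin 3)

/-! ## The pair force-constant operator -/

/-- **The pair force-constant operator** `K(w) = h(|w|²)·1 + 2h′(|w|²)·(w ⊗ w)`, `h(x) = −x⁻⁷ + x⁻⁴`,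
`h′(x) = 7x⁻⁸ − 4x⁻⁵`: the differential at the bond `w` of the Lennard-Jones pair force
`v ↦ (V′(|v|)/|v|)·v = h(|v|²)·v`; its quadratic form is the route's `Hess` (`inner_forceConst_eq_Hess₀`).
[folklore] -/
def forceConst (w : E3) : E3 →L[ℝ] E3 :=
  (-((‖w‖ ^ 2)⁻¹) ^ 7 + ((‖w‖ ^ 2)⁻¹) ^ 4) • ContinuousLinearMap.id ℝ E3 +
    (2 * (7 * ((‖w‖ ^ 2)⁻¹) ^ 8 - 4 * ((‖w‖ ^ 2)⁻¹) ^ 5)) • InnerProductSpace.rankOne ℝ w w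

/-- `K(w)d = h(|w|²)·d + (2⟪w,d⟫h′(|w|²))·w`. [folklore] -/
theorem forceConst_apply (w d : E3) :
    forceConst w d = (-((‖w‖ ^ 2)⁻¹) ^ 7 + ((‖w‖ ^ 2)⁻¹) ^ 4) • d +
      (2 * ⟪w, d⟫ * (7 * ((‖w‖ ^ 2)⁻¹) ^ 8 - 4 * ((‖w‖ ^ 2)⁻¹) ^ 5)) • w := by
  simp [forceConst]
  module

/-- **The force-constant operator is the differential of the pair force** at every bond of length
`≥ 9/10` (the Taylor remainder is `≤ 6000|w|⁻⁹|d|²`, `norm_ljForce_linearisation_le`). [folklore] -/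
theorem hasFDerivAt_ljForce {w : E3} (hw : 9 / 10 ≤ ‖w‖) :
    HasFDerivAt (fun v : E3 => (deriv lennardJones ‖v‖ / ‖v‖) • v) (forceConst w) w := by
  rw [hasFDerivAt_iff_isLittleO_nhds_zero, Asymptotics.isLittleO_iff]
  intro c hc
  set C : ℝ := 6000 * (‖w‖⁻¹) ^ 9 with hC
  have hC0 : 0 ≤ C := by positivity
  have hδ : 0 < min (1 / 10 : ℝ) (c / (C + 1)) := lt_min (by norm_num) (by positivity)
  filter_upwards [Metric.ball_mem_nhds (0 : E3) hδ] with d hd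
  rw [Metric.mem_ball, dist_zero_right] at hd
  have hd1 : ‖d‖ ≤ 1 / 10 := (hd.trans_le (min_le_left _ _)).le
  have hd2 : ‖d‖ ≤ c / (C + 1) := (hd.trans_le (min_le_right _ _)).le
  have hw0 : w ≠ 0 := by
    rintro rfl; rw [norm_zero] at hw; norm_num at hw
  have hwd : w + d ≠ 0 := by
    intro h
    have : ‖w‖ ≤ ‖w + d‖ + ‖d‖ := by
      have := norm_sub_le (w + d) d; rwa [add_sub_cancel_right] at this
    rw [h, norm_zero] at this
    linarith
  have hkey : ‖(deriv lennardJones ‖w + d‖ / ‖w + d‖) • (w + d) - (deriv lennardJones ‖w‖ / ‖w‖) • w -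
      forceConst w d‖ ≤ C * ‖d‖ ^ 2 := by
    rw [ljForce_eq_smul hwd, ljForce_eq_smul hw0, forceConst_apply]
    exact norm_ljForce_linearisation_le hw hd1
  calc ‖(deriv lennardJones ‖w + d‖ / ‖w + d‖) • (w + d) - (deriv lennardJones ‖w‖ / ‖w‖) • w -
        forceConst w d‖ ≤ C * ‖d‖ ^ 2 := hkey
    _ = (C * ‖d‖) * ‖d‖ := by ring
    _ ≤ c * ‖d‖ := by
      refine mul_le_mul_of_nonneg_right ?_ (norm_nonneg _)
      calc C * ‖d‖ ≤ C * (c / (C + 1)) := by gcongr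
        _ = c * (C / (C + 1)) := by ring
        _ ≤ c * 1 := by gcongr; rw [div_le_one (by positivity)]; linarith
        _ = c := mul_one c

/-- **Size of the force-constant operator**: `‖K(w)‖ ≤ 38|w|⁻⁸` for `|w| ≥ 9/10`. [folklore] -/
theorem norm_forceConst_le {w : E3} (hw : 9 / 10 ≤ ‖w‖) : ‖forceConst w‖ ≤ 38 * (‖w‖⁻¹) ^ 8 := by
  have hw0 : 0 < ‖w‖ := by linarith
  set u : ℝ := ‖w‖⁻¹ with hu
  have hu0 : 0 < u := inv_pos.2 hw0
  have huw : u * ‖w‖ = 1 := inv_mul_cancel₀ hw0.ne'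
  have hule : u ≤ 10 / 9 := by rw [hu]; exact inv_le_of_inv_le₀ (by norm_num) (by norm_num; exact hw)
  have hx : (‖w‖ ^ 2)⁻¹ = u ^ 2 := by rw [hu, inv_pow]
  have h1 : ‖(-((‖w‖ ^ 2)⁻¹) ^ 7 + ((‖w‖ ^ 2)⁻¹) ^ 4) • ContinuousLinearMap.id ℝ E3‖ ≤ u ^ 14 + u ^ 8 := by
    rw [hx, norm_smul, Real.norm_eq_abs]
    have ha : |-(u ^ 2) ^ 7 + (u ^ 2) ^ 4| ≤ u ^ 14 + u ^ 8 := by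
      rw [show (u ^ 2) ^ 7 = u ^ 14 by ring, show (u ^ 2) ^ 4 = u ^ 8 by ring]
      exact abs_le.2 ⟨by nlinarith [pow_nonneg hu0.le 14, pow_nonneg hu0.le 8],
        by nlinarith [pow_nonneg hu0.le 14, pow_nonneg hu0.le 8]⟩
    calc |-(u ^ 2) ^ 7 + (u ^ 2) ^ 4| * ‖ContinuousLinearMap.id ℝ E3‖
        ≤ (u ^ 14 + u ^ 8) * 1 :=
          mul_le_mul ha ContinuousLinearMap.norm_id_le (norm_nonneg _) (by positivity)
      _ = u ^ 14 + u ^ 8 := mul_one _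
  have h2 : ‖(2 * (7 * ((‖w‖ ^ 2)⁻¹) ^ 8 - 4 * ((‖w‖ ^ 2)⁻¹) ^ 5)) • InnerProductSpace.rankOne ℝ w w‖ ≤
      14 * u ^ 14 + 8 * u ^ 8 := by
    rw [hx, norm_smul, Real.norm_eq_abs, InnerProductSpace.norm_rankOne]
    have ha : |2 * (7 * (u ^ 2) ^ 8 - 4 * (u ^ 2) ^ 5)| ≤ 14 * u ^ 16 + 8 * u ^ 10 := by
      rw [show (u ^ 2) ^ 8 = u ^ 16 by ring, show (u ^ 2) ^ 5 = u ^ 10 by ring]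
      exact abs_le.2 ⟨by nlinarith [pow_nonneg hu0.le 16, pow_nonneg hu0.le 10],
        by nlinarith [pow_nonneg hu0.le 16, pow_nonneg hu0.le 10]⟩
    calc |2 * (7 * (u ^ 2) ^ 8 - 4 * (u ^ 2) ^ 5)| * (‖w‖ * ‖w‖)
        ≤ (14 * u ^ 16 + 8 * u ^ 10) * (‖w‖ * ‖w‖) :=
          mul_le_mul_of_nonneg_right ha (by positivity)
      _ = (14 * u ^ 14 + 8 * u ^ 8) * (u * ‖w‖) ^ 2 := by ring
      _ = 14 * u ^ 14 + 8 * u ^ 8 := by rw [huw, one_pow, mul_one]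
  have hu6 : u ^ 6 ≤ (10 / 9 : ℝ) ^ 6 := pow_le_pow_left₀ hu0.le hule 6
  have h14 : u ^ 14 ≤ (10 / 9 : ℝ) ^ 6 * u ^ 8 := by
    have : u ^ 14 = u ^ 6 * u ^ 8 := by ring
    rw [this]; exact mul_le_mul_of_nonneg_right hu6 (by positivity)
  calc ‖forceConst w‖ ≤ (u ^ 14 + u ^ 8) + (14 * u ^ 14 + 8 * u ^ 8) := norm_add_le_of_le h1 h2
    _ = 15 * u ^ 14 + 9 * u ^ 8 := by ring
    _ ≤ 15 * ((10 / 9 : ℝ) ^ 6 * u ^ 8) + 9 * u ^ 8 := by gcongr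
    _ = (15 * (10 / 9 : ℝ) ^ 6 + 9) * u ^ 8 := by ring
    _ ≤ 38 * u ^ 8 := by gcongr; norm_num

/-! ## The optical force and its differential -/

/-- **The optical force** of the cell `A` at the shift `e`: the Lennard-Jones force exerted on a site of
sublattice `1` by the whole of sublattice `0`, `Σ'_{z ∈ Λ₀} (V′(|e + Az|)/|e + Az|)·(e + Az)`. [folklore] -/
def optForce (A : E3 →L[ℝ] E3) (e : E3) : E3 :=
  ∑' z : Λ₀, (deriv lennardJones ‖e + A z‖ / ‖e + A z‖) • (e + A z)

/-- **The optical force-constant operator** `Σ'_{z ∈ Λ₀} K(e + Az)`. [folklore] -/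
def optForceConst (A : E3 →L[ℝ] E3) (e : E3) : E3 →L[ℝ] E3 :=
  ∑' z : Λ₀, forceConst (e + A z)

section

variable {A : E3 →L[ℝ] E3}

/-- The shifted lattice `A(w₀ + √(2/3)e₃ + Λ₀)` stays `189/200` away from the origin. [folklore] -/
theorem norm_apply_motif_add_ge (hA : Adm₀ A) {z : E3} (hz : z ∈ Λ₀) :
    189 / 200 ≤ ‖A (barlowOffset 1 + layerNormal (Real.sqrt (2 / 3)) + z)‖ := by
  have h1 := one_le_norm_motif_add hz
  have h2 := hcpLiouvilleAdm_norm_le hA (barlowOffset 1 + layerNormal (Real.sqrt (2 / 3)) + z)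
  linarith

/-- Bonds from the ball `|e − A(w₀+√(2/3)e₃)| < 3/100`: `|e + Az| ≥ (30/31)|A(w₀+√(2/3)e₃+z)|` and
`|e + Az| ≥ 9/10`. [folklore] -/
theorem norm_add_apply_ge (hA : Adm₀ A) {z : E3} (hz : z ∈ Λ₀) {e : E3}
    (he : e ∈ Metric.ball (A (barlowOffset 1 + layerNormal (Real.sqrt (2 / 3)))) (3 / 100)) :
    30 / 31 * ‖A (barlowOffset 1 + layerNormal (Real.sqrt (2 / 3)) + z)‖ ≤ ‖e + A z‖ ∧
      9 / 10 ≤ ‖e + A z‖ := by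
  rw [Metric.mem_ball, dist_eq_norm] at he
  have h1 := norm_apply_motif_add_ge hA hz
  have hsplit : A (barlowOffset 1 + layerNormal (Real.sqrt (2 / 3)) + z) =
      (e + A z) - (e - A (barlowOffset 1 + layerNormal (Real.sqrt (2 / 3)))) := by
    rw [map_add]; abel
  have h3 : ‖A (barlowOffset 1 + layerNormal (Real.sqrt (2 / 3)) + z)‖ ≤
      ‖e + A z‖ + ‖e - A (barlowOffset 1 + layerNormal (Real.sqrt (2 / 3)))‖ := by
    rw [hsplit]; exact norm_sub_le _ _
  constructor <;> linarith

/-- **Summable inverse eighth powers over the shifted lattice** `A(w₀+√(2/3)e₃+Λ₀)` (a `189/200`-separated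
set avoiding the `189/200`-ball at the origin; `summable_inv_pow_of_separated`). [folklore] -/
theorem summable_inv_pow_eight (hA : Adm₀ A) :
    Summable (fun z : Λ₀ => (‖A (barlowOffset 1 + layerNormal (Real.sqrt (2 / 3)) + z)‖⁻¹) ^ 8) := by
  set m : E3 := barlowOffset 1 + layerNormal (Real.sqrt (2 / 3)) with hm
  set X : Set E3 := (fun z : E3 => A (m + z)) '' Λ₀ with hX
  have hsep : ∀ a ∈ X, ∀ b ∈ X, a ≠ b → (189 / 200 : ℝ) ≤ dist a b := by
    rintro a ⟨z, hz, rfl⟩ b ⟨z', hz', rfl⟩ hne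
    have hzz : z ≠ z' := fun h => hne (by rw [h])
    show (189 / 200 : ℝ) ≤ dist (A (m + z)) (A (m + z'))
    rw [dist_eq_norm, ← map_sub, add_sub_add_left_eq_sub, map_sub]
    exact norm_sub_ge_of_adm₀ hA hz hz' hzz
  have hs := summable_inv_pow_of_separated (X := X) (0 : E3) (k := 5) (by norm_num)
    (by norm_num : (0 : ℝ) < 189 / 200) le_rfl hsep
  let i : Λ₀ → {a : E3 // a ∈ X ∧ (189 / 200 : ℝ) ≤ dist a 0} := fun z =>
    ⟨A (m + z), ⟨z, z.2, rfl⟩, by rw [dist_zero_right]; exact norm_apply_motif_add_ge hA z.2⟩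
  have hinj : Function.Injective i := by
    intro z z' h
    have h' : A (m + z) = A (m + z') :=
      congrArg (fun a : {a : E3 // a ∈ X ∧ (189 / 200 : ℝ) ≤ dist a 0} => (a : E3)) h
    exact Subtype.ext (add_left_cancel (injective_of_adm₀ hA h'))
  refine (hs.comp_injective hinj).congr fun z => ?_
  show (dist (A (m + z)) 0)⁻¹ ^ (5 + 3) = _
  rw [dist_zero_right]

/-- The optical force family is summable at every shift `e` of the closed `1/40`-window: it is the
cross-sublattice subfamily of the reference force family (`summable_refForce`) at the site `e` of the
datum `t = (0, e)`, indexed by `z ↦ −Az`. [folklore] -/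
theorem summable_optForce_of_mem (hA : Adm₀ A) {e : E3}
    (he : ‖e - A (barlowOffset 1 + layerNormal (Real.sqrt (2 / 3)))‖ ≤ 1 / 40) :
    Summable (fun z : Λ₀ => (deriv lennardJones ‖e + A z‖ / ‖e + A z‖) • (e + A (z : E3))) := by
  set t : Fin 2 → E3 := ![0, e] with ht
  have hI : Inner₀ t A := by
    unfold Inner₀; simpa [ht] using he
  have ht0 : t 0 = 0 := by simp [ht]
  have ht1 : t 1 = e := by simp [ht]
  have he1 : e ∈ Sites₀ t A := ⟨1, 0, zero_mem_Λ₀, by simp [ht1]⟩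
  have hmem : ∀ {z : E3}, z ∈ Λ₀ → -A z ∈ Sites₀ t A := fun {z} hz =>
    ⟨0, -z, neg_mem_Λ₀ hz, by rw [map_neg, ht0, zero_add]⟩
  have hne : ∀ {z : E3}, z ∈ Λ₀ → -A z ≠ e := by
    intro z hz h
    have hd := dist_sites_cross_ge hA hI (neg_mem_Λ₀ hz) zero_mem_Λ₀
    rw [map_zero, add_zero, map_neg, ht0, zero_add, h, ht1, dist_self] at hd
    norm_num at hd
  let i : Λ₀ → {q : E3 // q ∈ Sites₀ t A ∧ q ≠ e} := fun z => ⟨-A z, hmem z.2, hne z.2⟩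
  have hinj : Function.Injective i := by
    intro z z' h
    have h' : -A z = -A z' := congrArg (fun q : {q : E3 // q ∈ Sites₀ t A ∧ q ≠ e} => (q : E3)) h
    exact Subtype.ext (injective_of_adm₀ hA (neg_injective h'))
  have hs := (summable_refForce hA hI he1).comp_injective hinj
  refine hs.congr fun z => ?_
  show (deriv lennardJones (dist e (-A z)) / dist e (-A z)) • (e - -A z) = _
  rw [dist_eq_norm, sub_neg_eq_add]

/-- **The optical force is differentiable on the ball `|e − A(w₀+√(2/3)e₃)| < 3/100`, with differential
the optical force-constant operator** (termwise differentiation of the lattice sum: each term has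
differential `K(e + Az)` of norm `≤ 38|e + Az|⁻⁸ ≤ 50|A(w₀+√(2/3)e₃+z)|⁻⁸`, a summable majorant).
[folklore] -/
theorem hasFDerivAt_optForce (hA : Adm₀ A) {e : E3}
    (he : e ∈ Metric.ball (A (barlowOffset 1 + layerNormal (Real.sqrt (2 / 3)))) (3 / 100)) :
    HasFDerivAt (optForce A) (optForceConst A e) e := by
  set m : E3 := barlowOffset 1 + layerNormal (Real.sqrt (2 / 3)) with hm
  have hu : Summable (fun z : Λ₀ => 50 * (‖A (m + z)‖⁻¹) ^ 8) := (summable_inv_pow_eight hA).mul_left 50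
  have hf : ∀ (z : Λ₀) (x : E3), x ∈ Metric.ball (A m) (3 / 100) →
      HasFDerivAt (fun y : E3 => (deriv lennardJones ‖y + A z‖ / ‖y + A z‖) • (y + A z))
        (forceConst (x + A z)) x := by
    intro z x hx
    exact (hasFDerivAt_comp_add_right (f := fun v : E3 => (deriv lennardJones ‖v‖ / ‖v‖) • v) (A z)).2
      (hasFDerivAt_ljForce (norm_add_apply_ge hA z.2 hx).2)
  have hf' : ∀ (z : Λ₀) (x : E3), x ∈ Metric.ball (A m) (3 / 100) →
      ‖forceConst (x + A z)‖ ≤ 50 * (‖A (m + z)‖⁻¹) ^ 8 := by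
    intro z x hx
    obtain ⟨h1, h2⟩ := norm_add_apply_ge hA z.2 hx
    have h0 : 0 < 30 / 31 * ‖A (m + z)‖ := by
      have := norm_apply_motif_add_ge hA z.2; rw [← hm] at this; positivity
    have h3 : (‖x + A z‖⁻¹) ^ 8 ≤ ((30 / 31 * ‖A (m + z)‖)⁻¹) ^ 8 :=
      pow_le_pow_left₀ (inv_nonneg.2 (norm_nonneg _)) (inv_anti₀ h0 h1) 8
    calc ‖forceConst (x + A z)‖ ≤ 38 * (‖x + A z‖⁻¹) ^ 8 := norm_forceConst_le h2
      _ ≤ 38 * ((30 / 31 * ‖A (m + z)‖)⁻¹) ^ 8 := by gcongr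
      _ = (38 * ((30 / 31 : ℝ)⁻¹) ^ 8) * (‖A (m + z)‖⁻¹) ^ 8 := by rw [mul_inv, mul_pow]; ring
      _ ≤ 50 * (‖A (m + z)‖⁻¹) ^ 8 := by gcongr; norm_num
  have hx₀ : A m ∈ Metric.ball (A m) (3 / 100) := Metric.mem_ball_self (by norm_num)
  have hf0 : Summable (fun z : Λ₀ => (deriv lennardJones ‖A m + A z‖ / ‖A m + A z‖) • (A m + A (z : E3))) :=
    summable_optForce_of_mem hA (by rw [sub_self, norm_zero]; norm_num)
  exact hasFDerivAt_tsum_of_isPreconnected hu Metric.isOpen_ball (convex_ball _ _).isPreconnected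
    hf hf' hx₀ hf0 he

end

/-! ## Newton–Kantorovich: a zero from a contraction certificate -/

/-- **Banach's fixed point theorem for the simplified Newton map.**  If `M` is injective,
`x ↦ x − M(g x)` is `q`-contracting on the closed ball `closedBall c r` (`0 ≤ q < 1`, `0 ≤ r`) and
`‖M(g c)‖ ≤ (1 − q)·r`, then `g` has a zero in the ball. [folklore] -/
theorem exists_zero_of_newton_contract {g : E3 → E3} (M : E3 →L[ℝ] E3) (hM : Function.Injective M)
    {c : E3} {r q : ℝ} (hr : 0 ≤ r) (hq : 0 ≤ q) (hq1 : q < 1)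
    (hcontr : ∀ x ∈ Metric.closedBall c r, ∀ y ∈ Metric.closedBall c r,
      ‖(x - M (g x)) - (y - M (g y))‖ ≤ q * ‖x - y‖)
    (hc : ‖M (g c)‖ ≤ (1 - q) * r) :
    ∃ x ∈ Metric.closedBall c r, g x = 0 := by
  set T : E3 → E3 := fun x => x - M (g x) with hT
  have hcm : c ∈ Metric.closedBall c r := Metric.mem_closedBall_self hr
  have hmaps : Set.MapsTo T (Metric.closedBall c r) (Metric.closedBall c r) := by
    intro x hx
    rw [Metric.mem_closedBall, dist_eq_norm] at hx ⊢
    have h1 := hcontr x (by rwa [Metric.mem_closedBall, dist_eq_norm]) c hcm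
    have hsplit : T x - c = ((x - M (g x)) - (c - M (g c))) + (-M (g c)) := by simp only [hT]; abel
    calc ‖T x - c‖ ≤ ‖(x - M (g x)) - (c - M (g c))‖ + ‖-M (g c)‖ := by rw [hsplit]; exact norm_add_le _ _
      _ ≤ q * ‖x - c‖ + (1 - q) * r := by rw [norm_neg]; exact add_le_add h1 hc
      _ ≤ q * r + (1 - q) * r := by gcongr
      _ = r := by ring
  set K : NNReal := ⟨q, hq⟩ with hK
  have hlip : LipschitzOnWith K T (Metric.closedBall c r) :=
    LipschitzOnWith.of_dist_le_mul fun x hx y hy => by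
      rw [dist_eq_norm, dist_eq_norm]; exact hcontr x hx y hy
  have hcw : ContractingWith K (hmaps.restrict T _ _) :=
    ⟨by rw [← NNReal.coe_lt_coe]; exact hq1, hlip.mapsToRestrict hmaps⟩
  obtain ⟨y, hy, hfix, -⟩ := ContractingWith.exists_fixedPoint' Metric.isClosed_closedBall.isComplete
    hmaps hcw hcm (edist_ne_top _ _)
  refine ⟨y, hy, hM ?_⟩
  have h : y - M (g y) = y := hfix
  rw [map_zero]
  exact sub_eq_self.1 h

/-- **Registered sub-goal `stub_anchorNewton`** (crux stmt-AtomisticToContinuum-9332, line `Sketch`): a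
Newton–Kantorovich certificate for the relaxed shift.  If, for an admissible cell `A`, an injective
preconditioner `M`, a centre `c` and a radius `r ≥ 0` with `closedBall c r` inside the `1/40`-window of the
ideal shift, and a contraction rate `0 ≤ q < 1`, the residual operators `1 − M ∘ optForceConst A e` have
norm `≤ q` on `closedBall c r` and the first Newton step is short, `‖M(optForce A c)‖ ≤ (1 − q)·r`, then the
optical force of `A` vanishes at some shift within `1/40` of the ideal one (mean value theorem + Banach
fixed point; the conclusion is the `RelaxedShift` input of `stub_anchorReduction`). [folklore] -/
theorem stub_anchorNewton : ∀ (A M : E3 →L[ℝ] E3) (c : E3) (r q : ℝ), Adm₀ A → Function.Injective M → 0 ≤ r → 0 ≤ q → q < 1 → Metric.closedBall c r ⊆ Metric.closedBall (A (barlowOffset 1 + layerNormal (Real.sqrt (2 / 3)))) (1 / 40) → (∀ e ∈ Metric.closedBall c r, ‖ContinuousLinearMap.id ℝ E3 - M.comp (optForceConst A e)‖ ≤ q) → ‖M (optForce A c)‖ ≤ (1 - q) * r → ∃ e : E3, ‖e - A (barlowOffset 1 + layerNormal (Real.sqrt (2 / 3)))‖ ≤ 1 / 40 ∧ HasSum (fun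 z : Λ₀ => (deriv lennardJones ‖e + A z‖ / ‖e + A z‖) • (e + A z)) 0 := by
  intro A M c r q hA hM hr hq hq1 hball hK hc
  set m : E3 := barlowOffset 1 + layerNormal (Real.sqrt (2 / 3)) with hm
  have hsub : Metric.closedBall c r ⊆ Metric.ball (A m) (3 / 100) :=
    hball.trans (Metric.closedBall_subset_ball (by norm_num))
  -- the simplified Newton map is `q`-contracting on the ball (mean value theorem)
  have hderiv : ∀ x ∈ Metric.closedBall c r,
      HasFDerivWithinAt (fun x : E3 => x - M (optForce A x))
        (ContinuousLinearMap.id ℝ E3 - M.comp (optForceConst A x)) (Metric.closedBall c r) x := by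
    intro x hx
    exact ((hasFDerivAt_id x).sub (M.hasFDerivAt.comp x (hasFDerivAt_optForce hA (hsub hx)))).hasFDerivWithinAt
  have hcontr : ∀ x ∈ Metric.closedBall c r, ∀ y ∈ Metric.closedBall c r,
      ‖(x - M (optForce A x)) - (y - M (optForce A y))‖ ≤ q * ‖x - y‖ :=
    fun x hx y hy => (convex_closedBall c r).norm_image_sub_le_of_norm_hasFDerivWithin_le
      (f := fun x : E3 => x - M (optForce A x)) hderiv hK hy hx
  obtain ⟨e, he, h0⟩ := exists_zero_of_newton_contract (g := optForce A) M hM hr hq hq1 hcontr hc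
  have he' : ‖e - A m‖ ≤ 1 / 40 := by
    have := hball he; rwa [Metric.mem_closedBall, dist_eq_norm] at this
  refine ⟨e, he', ?_⟩
  have h0' : (∑' z : Λ₀, (deriv lennardJones ‖e + A z‖ / ‖e + A z‖) • (e + A (z : E3))) = 0 := h0
  rwa [← (summable_optForce_of_mem hA he').hasSum_iff] at h0'

end Summit.AtomisticToContinuum.Crystallization.Theorems.ExcessDecayLiouville

end
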